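import Literature.MathematicalPhysics.QuantumLattice.ExponentialGaugeConnection
import Mathlib.Analysis.Calculus.MeanValue
import HarnessLib

/-!
# The transition map between two exponential gauges: derivative and Lipschitz bound

QuantumLattice support file (everything proved; one definition, no named facts) on the proof
path of `Literature.MathematicalPhysics.QuantumLattice.Waldron2019_yangMillsFlow_flatTorus`
(A. Waldron, Invent. math. 217 (2019)), Lemma 3.5 / §4 (gluing two local good gauges on a
sphere into a global one). For the exponential gauges `g₁ = expGauge c₁ A`, `g₂ = expGauge c₂ A`
with gauged connections `Ã₁, Ã₂` (`ExponentialGaugeConnection`):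

* `fderiv_expGauge_eq` — `dg = g Ã − A g`;
* `gaugeTransition hA c₁ c₂ = g₁⁻¹ g₂`, `contDiff_gaugeTransition`;
* `fderiv_gaugeTransition` — **`d(g₁⁻¹g₂) = −Ã₁ h + h Ã₂`** (the `A`-terms cancel);
* `norm_fderiv_gaugeTransition_le`, `norm_gaugeTransition_sub_le` — where both gauged
  connections are small, `‖Ãᵢ(w)v‖ ≤ m‖v‖`, and `‖h‖, ‖·‖` are controlled, `h` is Lipschitz with
  constant `2 m K` along segments (mean value inequality), hence close to a constant.

References: A. Waldron, Invent. math. 217 (2019), §3–§4 [Waldron2019]; K. Uhlenbeck, Comm.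
Math. Phys. 83 (1982) (patching of gauges) [folklore].
-/

noncomputable section

open Set Metric Filter
open scoped Topology

namespace Literature.MathematicalPhysics.QuantumLattice

universe u

section Transition

variable {E : Type u} [NormedAddCommGroup E] [InnerProductSpace ℝ E] [CompleteSpace E]
variable {𝔸 : Type u} [NormedRing 𝔸] [NormedAlgebra ℝ 𝔸] [CompleteSpace 𝔸]

/-- **`dg(v) = g Ã(v) − A(v) g`** for the exponential gauge `g` and its gauged connection `Ã`.
[folklore] -/
theorem fderiv_expGauge_eq {A : Connection E 𝔸} (hA : ContDiff ℝ 1 A) (c x v : E) :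
    fderiv ℝ (expGauge c A) x v = expGauge c A x * expConn hA c x v - A x v * expGauge c A x := by
  have hu : expGauge c A x * (((expGaugeUnit hA c x)⁻¹ : 𝔸ˣ) : 𝔸) = 1 := by
    rw [← val_expGaugeUnit hA c x]; exact Units.mul_inv _
  rw [expConn_apply, mul_add, ← mul_assoc, ← mul_assoc, ← mul_assoc, hu, one_mul, one_mul]
  abel

/-- **The transition map** `h = g₁⁻¹ g₂` between the exponential gauges centred at `c₁, c₂`.
[folklore] -/
def gaugeTransition {A : Connection E 𝔸} (hA : ContDiff ℝ 1 A) (c₁ c₂ : E) (x : E) : 𝔸 :=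
  (((expGaugeUnit hA c₁ x)⁻¹ : 𝔸ˣ) : 𝔸) * expGauge c₂ A x

/-- Smoothness of the transition map. [folklore] -/
theorem contDiff_gaugeTransition {n : ℕ∞} (hn : 1 ≤ n) {A : Connection E 𝔸} (hA : ContDiff ℝ n A)
    (c₁ c₂ : E) :
    ContDiff ℝ n (gaugeTransition (hA.of_le (by exact_mod_cast hn)) c₁ c₂) :=
  (contDiff_expGaugeUnit_inv hn hA c₁).mul (contDiff_expGauge hn hA c₂)

/-- **Derivative of the transition map**: `dh(v) = −Ã₁(v) h + h Ã₂(v)`. [folklore] -/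
theorem fderiv_gaugeTransition {A : Connection E 𝔸} (hA : ContDiff ℝ 1 A) (c₁ c₂ x v : E) :
    fderiv ℝ (gaugeTransition hA c₁ c₂) x v =
      -(expConn hA c₁ x v * gaugeTransition hA c₁ c₂ x) +
        gaugeTransition hA c₁ c₂ x * expConn hA c₂ x v := by
  have hg1 : Differentiable ℝ (expGauge c₁ A) := (contDiff_expGauge le_rfl hA c₁).differentiable (by simp)
  have hg2 : Differentiable ℝ (expGauge c₂ A) := (contDiff_expGauge le_rfl hA c₂).differentiable (by simp)
  have hinvd : Differentiable ℝ fun y => (((expGaugeUnit hA c₁ y)⁻¹ : 𝔸ˣ) : 𝔸) :=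
    (contDiff_expGaugeUnit_inv le_rfl hA c₁).differentiable (by simp)
  -- derivative of the inverse factor: `d(g₁⁻¹)(v) = −g₁⁻¹ dg₁(v) g₁⁻¹`
  have hinv : fderiv ℝ (fun y => (((expGaugeUnit hA c₁ y)⁻¹ : 𝔸ˣ) : 𝔸)) x v =
      -((((expGaugeUnit hA c₁ x)⁻¹ : 𝔸ˣ) : 𝔸) * fderiv ℝ (expGauge c₁ A) x v *
        (((expGaugeUnit hA c₁ x)⁻¹ : 𝔸ˣ) : 𝔸)) := by
    have heq : (fun y => (((expGaugeUnit hA c₁ y)⁻¹ : 𝔸ˣ) : 𝔸)) = fun y => Ring.inverse (expGauge c₁ A y) := by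
      funext y; rw [← val_expGaugeUnit hA c₁ y, Ring.inverse_unit]
    rw [heq]
    have h1 : HasFDerivAt (𝕜 := ℝ) Ring.inverse
        (-ContinuousLinearMap.mulLeftRight ℝ 𝔸 (((expGaugeUnit hA c₁ x)⁻¹ : 𝔸ˣ) : 𝔸)
          (((expGaugeUnit hA c₁ x)⁻¹ : 𝔸ˣ) : 𝔸)) (expGauge c₁ A x) :=
      hasFDerivAt_ringInverse (expGaugeUnit hA c₁ x)
    have h2 : HasFDerivAt (fun y => Ring.inverse (expGauge c₁ A y))
        ((-ContinuousLinearMap.mulLeftRight ℝ 𝔸 (((expGaugeUnit hA c₁ x)⁻¹ : 𝔸ˣ) : 𝔸)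
          (((expGaugeUnit hA c₁ x)⁻¹ : 𝔸ˣ) : 𝔸)).comp (fderiv ℝ (expGauge c₁ A) x)) x :=
      h1.comp x (hg1 x).hasFDerivAt
    rw [h2.fderiv]
    simp
  -- product rule (noncommutative): `d(ab)(v) = a(x) db(v) + da(v) b(x)`
  have hprod : fderiv ℝ (gaugeTransition hA c₁ c₂) x v =
      (((expGaugeUnit hA c₁ x)⁻¹ : 𝔸ˣ) : 𝔸) * fderiv ℝ (expGauge c₂ A) x v +
        fderiv ℝ (fun y => (((expGaugeUnit hA c₁ y)⁻¹ : 𝔸ˣ) : 𝔸)) x v * expGauge c₂ A x := by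
    unfold gaugeTransition
    rw [fderiv_fun_mul' (hinvd x) (hg2 x)]
    simp only [FunLike.coe_add, Pi.add_apply, smul_apply, smul_eq_mul,
      MulOpposite.smul_eq_mul_unop, MulOpposite.unop_op]
  rw [hprod, hinv, fderiv_expGauge_eq hA c₂ x v, fderiv_expGauge_eq hA c₁ x v]
  -- cancel `g₁⁻¹ g₁ = 1` and the `A`-terms
  have hu1 : (((expGaugeUnit hA c₁ x)⁻¹ : 𝔸ˣ) : 𝔸) * expGauge c₁ A x = 1 := by
    rw [← val_expGaugeUnit hA c₁ x]; exact Units.inv_mul _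
  have hu1' : expGauge c₁ A x * (((expGaugeUnit hA c₁ x)⁻¹ : 𝔸ˣ) : 𝔸) = 1 := by
    rw [← val_expGaugeUnit hA c₁ x]; exact Units.mul_inv _
  unfold gaugeTransition
  set gi := (((expGaugeUnit hA c₁ x)⁻¹ : 𝔸ˣ) : 𝔸) with hgi
  set g₁ := expGauge c₁ A x with hg₁
  set g₂ := expGauge c₂ A x with hg₂
  have key : gi * (g₁ * expConn hA c₁ x v - A x v * g₁) * gi =
      (gi * g₁) * expConn hA c₁ x v * gi - gi * A x v * (g₁ * gi) := by noncomm_ring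
  rw [key, hu1, hu1']
  noncomm_ring

/-- **Pointwise bound on the derivative of the transition map.** [folklore] -/
theorem norm_fderiv_gaugeTransition_le {A : Connection E 𝔸} (hA : ContDiff ℝ 1 A) (c₁ c₂ : E)
    {w : E} {m K : ℝ} (hm : 0 ≤ m) (hK : 0 ≤ K)
    (h1 : ∀ v, ‖expConn hA c₁ w v‖ ≤ m * ‖v‖) (h2 : ∀ v, ‖expConn hA c₂ w v‖ ≤ m * ‖v‖)
    (hh : ‖gaugeTransition hA c₁ c₂ w‖ ≤ K) :
    ‖fderiv ℝ (gaugeTransition hA c₁ c₂) w‖ ≤ 2 * m * K := by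
  refine ContinuousLinearMap.opNorm_le_bound _ (by positivity) fun v => ?_
  rw [fderiv_gaugeTransition hA c₁ c₂ w v]
  calc ‖-(expConn hA c₁ w v * gaugeTransition hA c₁ c₂ w) +
        gaugeTransition hA c₁ c₂ w * expConn hA c₂ w v‖
      ≤ ‖expConn hA c₁ w v * gaugeTransition hA c₁ c₂ w‖ +
          ‖gaugeTransition hA c₁ c₂ w * expConn hA c₂ w v‖ := by
        refine (norm_add_le _ _).trans ?_; rw [norm_neg]
    _ ≤ m * ‖v‖ * K + K * (m * ‖v‖) := by
        refine add_le_add ((norm_mul_le _ _).trans ?_) ((norm_mul_le _ _).trans ?_)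
        · exact mul_le_mul (h1 v) hh (norm_nonneg _) (by positivity)
        · exact mul_le_mul hh (h2 v) (norm_nonneg _) hK
    _ = 2 * m * K * ‖v‖ := by ring

/-- **The transition map is close to a constant where both gauges are small**: on a convex set
`s` on which `‖Ãᵢ(w)v‖ ≤ m‖v‖` (`i = 1, 2`) and `‖h(w)‖ ≤ K`,
`‖h(z') − h(z)‖ ≤ 2 m K ‖z' − z‖` (mean value inequality). [folklore] -/
theorem norm_gaugeTransition_sub_le {A : Connection E 𝔸} (hA : ContDiff ℝ 1 A) (c₁ c₂ : E)
    {s : Set E} (hs : Convex ℝ s) {m K : ℝ} (hm : 0 ≤ m) (hK : 0 ≤ K)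
    (h1 : ∀ w ∈ s, ∀ v, ‖expConn hA c₁ w v‖ ≤ m * ‖v‖)
    (h2 : ∀ w ∈ s, ∀ v, ‖expConn hA c₂ w v‖ ≤ m * ‖v‖)
    (hh : ∀ w ∈ s, ‖gaugeTransition hA c₁ c₂ w‖ ≤ K) {z z' : E} (hz : z ∈ s) (hz' : z' ∈ s) :
    ‖gaugeTransition hA c₁ c₂ z' - gaugeTransition hA c₁ c₂ z‖ ≤ 2 * m * K * ‖z' - z‖ := by
  have hd : Differentiable ℝ (gaugeTransition hA c₁ c₂) :=
    (contDiff_gaugeTransition le_rfl hA c₁ c₂).differentiable (by simp)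
  exact hs.norm_image_sub_le_of_norm_fderiv_le (fun w _ => hd w)
    (fun w hw => norm_fderiv_gaugeTransition_le hA c₁ c₂ hm hK (h1 w hw) (h2 w hw) (hh w hw)) hz hz'

end Transition

end Literature.MathematicalPhysics.QuantumLattice
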